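import Literature.Topology.FourManifolds.LatticeFormsStableOrthogonalGroupReflections
import Literature.Topology.FourManifolds.LatticeFormsEichlerCriterionDivisor
import Literature.Topology.FourManifolds.LatticeFormsRankOneDiscriminantFormIsometries
import Literature.Topology.FourManifolds.LatticeFormsTwoElementary
import Mathlib.GroupTheory.Exponent
import HarnessLib

/-!
# Reflections acting as `−id` on the discriminant group: `−σ_r ∈ Õ(L)`
# (Gritsenko–Hulek–Sankaran, *The Kodaira dimension of the moduli of K3 surfaces*, §4 Prop. 4.2 of arXiv:math/0607339)

Trunk T-4MAN vocabulary; sequel of `LatticeFormsStableOrthogonalGroupReflections.lean` (row g39-#4: Prop. 4.1,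
`σ_r ∈ Õ(L) ⟺ r² = ±2`), of `LatticeFormsEichlerCriterionDivisor.lean` (the divisor `div(u)`: `(u, L) = dℤ`,
`u* = u/d ∈ L^∨`, `ord_{A_L}[u*] = div(u)`), of `LatticeFormsRankOneDiscriminantFormIsometries.lean` (`(−1)‾ = −1` on
`A_L`) and of `LatticeFormsTwoElementary.lean` (`2·A_L = 0`). Written for lane `lit-hodgefound` (Track 2 foundations;
prover seat `lit-hodgefound-p18`, gen 40, row g40-#1). THEOREMS ONLY — no definition, no named fact, no instance, no
notation. As in g39-#4, a reflection `σ_r` (`(r,r) ≠ 0`) is any `g ∈ O(L)` (`B.IsometryEquiv B`) with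
`(r,r)·g(l) = (r,r)·l − 2(l,r)·r` for all `l`; "`r` primitive" is saturation of `ℤr`; the divisor `div(r) = d > 0` is
given by `d ∣ (r, z)` for all `z` and `(r, r') = d` for some `r'`, and `r* = f ∈ L^∨` by `d•f = (r, ·)`;
**"`−σ_r ∈ Õ(L)`, i.e. `σ_r|_{A_L} = −id`"** is `∀ a, ḡ a = −a` (`IsometryEquiv.discriminantGroupCongr`), equivalently
`((−1) ∘ g)‾ = id` (`forall_discriminantGroupCongr_eq_neg_iff`); `D` is the exponent `AddMonoid.exponent A_L` of the
discriminant group; `A_L[2]` is written "`t` with `2•t = 0`".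

## Source, verbatim (V. Gritsenko, K. Hulek, G. K. Sankaran, Invent. Math. 169 (2007) 519–567; held text
## `paper:arxiv-math_0607339` p. 14, arXiv numbering "§4 Special reflections in `Õ(L)`")

"Let `L` be an arbitrary nondegenerate integral lattice, and write `D` for the exponent of the finite group
`A_L = L^∨/L`. […] For any `l ∈ L` its divisor `div(l)` in `L` is the positive generator of the ideal `(l, L)`. In
other words `l* = l/div(l)` is a primitive element of the dual lattice `L^∨`. If `r` is primitive and the reflection
`σ_r` fixes `L`, i.e. `σ_r ∈ O(L)`, then we say that `r` is a reflective vector. In this case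
(refldiv) `div(r) ∣ r² ∣ 2 div(r)`. […]
**Proposition 4.2.** Let `L` be as in Proposition 4.1 [a nondegenerate even integral lattice] and let `r ∈ L` be
primitive. If `−σ_r ∈ Õ(L)`, i.e. `σ_r|_{A_L} = −id`, then
(i) `r² = ±2D` and `div(r) = D ≡ 1 mod 2`, or `r² = ±D` and `div(r) = D` or `D/2`;
(ii) `A_L ≅ (ℤ/2ℤ)^m × (ℤ/Dℤ)`.
In the opposite direction we have
(iii) If `r² = ±D` and either `div(r) = D` or `div(r) = D/2 ≡ 1 mod 2`, then `−σ_r ∈ Õ(L)`;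
(iv) If `r² = ±2D` and `div(r) = D ≡ 1 mod 2`, then `−σ_r ∈ Õ(L)`.
*Proof.* (i) `σ_r|_{A_L} = −id` is equivalent to the following condition: (−id) `2l^∨ ≡ (2(r,l^∨)/r²) r mod L`
for all `l^∨ ∈ L^∨`. It follows that if `r² = 2e`, then `(2L^∨)/L` is a subgroup of the cyclic group `⟨(r/e)+L⟩`.
Thus `D` divides `2e`. But by definition of the divisor of the vector `e ∣ div(r) ∣ D`, therefore `e ∣ div(r) ∣ 2e`
and `e ∣ D ∣ 2e`. From this it follows that `(2L^∨)/L` is a subgroup of the cyclic group generated by `(r/D)+L` or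
`(2r/D)+L`. This implies (ii). […] Thus (i) is proved.
(iii) Let assume that `div(r) = D`. In this case `r* = r/D` and `2r* + L` is a generator of `(2L^∨)/L`. According to
(ii) we have that for any `l^∨ ∈ L^∨`, `2l^∨ = 2x r* + l'`, where `x ∈ ℤ`, `l' ∈ L`. Therefore
`((2l^∨, r)/r²) r = 2x r* ± ((l', r)/D) r ≡ 2x r* ≡ 2l^∨ mod L` and `−σ_r ∈ Õ(L)` according to condition (−id).
Let assume that `div(r) = D/2 ≡ 1 mod 2`. […] If `l^∨` is an element of order `D`, we have `2l^∨ = 2x r* + l'` as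
above with `r* = (2r)/D` and `l' ∈ L`. Thus `(l', r)` is even. But `(l', r)` is also divisible by the odd number
`D/2`. Therefore `(l', r) ≡ 0 mod D` and equation (DD) is also true.
(iv) is similar to (iii). `D` is odd and the group `A_L` is cyclic with generator `r* = r/D`. […] □"

## Reading notes (what the printed proof uses, and two boundary remarks)

* The converses (iii), (iv) are proved in the source FROM (ii) ("According to (ii) …", "the group `A_L` is cyclic
  with generator `r*`"): they are converses of (i) under (ii), and are stated here with (ii) as an explicit hypothesis
  (in the internal form `A_L = ℤx + A_L[2]`, `ord x = D`, which implies the printed product form — §6). Without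
  (ii) they fail: in `U(3)` the vector `r = e + f` has `r² = 6 = 2D`, `div(r) = 3 = D` odd, and
  `σ̄_r(a, b) = (−b, −a) ≠ −id` on `A = (ℤ/3)²`.
* What (−id) amounts to in the two cases of (refldiv) (§3–§4): for `div(r) = |r²|`,
  `−σ_r ∈ Õ(L) ⟺ A_L = ℤ[r*] + A_L[2]`; for `2div(r) = |r²|`, `−σ_r ∈ Õ(L) ⟹ 2A_L ⊆ ℤ[r*]`, with the converse
  when `div(r)` is odd. The remaining printed branch of (i), `r² = ±D` with `div(r) = D/2` EVEN, has no printed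
  converse (it occurs: `D₃ ∋ r = 2e₁`; and it can fail under (i)–(ii): `D₃ ⊕ ⟨2⟩ ⊕ ⟨2⟩ ∋ r = a + b`) — NOT here.

## Contents (all proved; `A = A_L`, `[r*] = Submodule.Quotient.mk f` with `d•f = (r,·)`, `r² = c·d`, `c·c' = 2`)

* §1 reflective vectors: `apply_self_dvd_two_mul_of_reflection` (`r² ∣ 2div(r)`),
  `exists_mul_eq_two_and_apply_self_eq_mul_divisor` (`r² = c·div(r)`, `c·c' = 2`), `dual_apply_self_eq_of_smul_eq`
  (`r*(r) = c`), `reflection_apply_eq_sub_smul` (`σ_r(l) = l − c'·r*(l)·r`), `symm_dualMap_eq_of_reflection`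
  (`σ_r^*φ = φ − c'φ(r)·r*`).
* §2 `forall_discriminantGroupCongr_eq_neg_iff` (`((−1)∘σ_r)‾ = id ⟺ ∀ a, σ̄_r a = −a`),
  `forall_discriminantGroupCongr_eq_neg_iff_mk` (condition (−id): `∀ φ, 2[φ] = c'φ(r)·[r*]`).
* §3a finite abelian groups `A = ℤx + A[2]`: `zmultiples_eq_of_mem_of_addOrderOf_eq`, `addOrderOf_two_zsmul`,
  `exponent_dvd_two_mul_addOrderOf_of_forall_eq_zsmul_add`, `exponent_eq_addOrderOf_of_forall_eq_zsmul_add_of_even`,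
  `exists_addOrderOf_eq_exponent_of_forall_eq_zsmul_add` (an `x` of order `exp(A)` also works),
  `eq_zero_of_two_zsmul_eq_zero_of_odd_exponent`.
* §3 necessity: `forall_eq_zsmul_mk_add_of_discriminantGroupCongr_eq_neg` (`c = ±1`: `A = ℤ[r*] + A[2]`),
  `two_zsmul_mem_zmultiples_mk_of_discriminantGroupCongr_eq_neg` (`2A ⊆ ℤ[r*]`),
  `forall_eq_zsmul_mk_add_of_discriminantGroupCongr_eq_neg_of_apply_eq_one` (`A = ℤ[φ₀] + A[2]`, `φ₀(r) = 1`),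
  `exponent_eq_divisor_of_discriminantGroupCongr_eq_neg` (`c = ±1`: `D = div(r)`),
  `exponent_eq_or_of_discriminantGroupCongr_eq_neg` (`c = ±2`: `D = div(r)` odd, or `D = 2div(r)`),
  **`apply_self_eq_and_divisor_eq_exponent_of_discriminantGroupCongr_eq_neg` = (i) as printed**,
  **`exists_addOrderOf_eq_exponent_of_discriminantGroupCongr_eq_neg` = (ii), internal form**.
* §4 sufficiency: `discriminantGroupCongr_eq_neg_of_forall_eq_zsmul_mk_add` (`c = ±1`, `A = ℤ[r*] + A[2]`),
  `discriminantGroupCongr_eq_neg_of_two_zsmul_mem_zmultiples_mk` (`c = ±2`, `div(r)` odd, `2A ⊆ ℤ[r*]`).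
* §5 **`discriminantGroupCongr_eq_neg_of_apply_self_eq_exponent` = (iii)** and
  **`discriminantGroupCongr_eq_neg_of_apply_self_eq_two_mul_exponent` = (iv)**, as printed, under (ii).
* §6 `exists_addEquiv_zmod_prod_of_forall_eq_zsmul_add` (`A = ℤx + A[2] ⟹ A ≅ ℤ/ord(x) × (ℤ/2)^m`),
  **`exists_addEquiv_prod_of_discriminantGroupCongr_eq_neg` = (ii) as printed, `A_L ≅ (ℤ/2)^m × ℤ/D`**.

## References

* [GritsenkoHulekSankaran2007Kodaira] V. Gritsenko, K. Hulek, G. K. Sankaran, The Kodaira dimension of the moduli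
  of K3 surfaces, Invent. Math. 169 (2007) 519–567 (arXiv:math/0607339): §4 (arXiv numbering) eq. (refldiv),
  Prop. 4.2 (i)–(iv) and its proof.
* [GritsenkoHulekSankaran2009] V. Gritsenko, K. Hulek, G. K. Sankaran, Abelianisation of orthogonal groups and the
  fundamental group of modular varieties, J. Algebra 322 (2009): §3.3 (divisor, `l* = l/div(l)`).
* [DummitFoote2004] D. S. Dummit, R. M. Foote, Abstract Algebra, 3rd ed., Wiley 2004: §2.3 Prop. 5, Thm. 7 (orders in and
  subgroups of cyclic groups), §5.2 (exponent), §6.1 (abelian `p`-groups as direct products) — for the group lemmas of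
  §3a and §6.
-/

noncomputable section

open Module Function
open LinearMap (BilinForm)
open LinearMap.BilinForm

namespace Literature.Topology.FourManifolds

universe u

/-! ### §1 Reflective vectors: `div(r) ∣ r² ∣ 2div(r)`, `σ_r(l) = l − c'·r*(l)·r` -/

section Reflective

variable {M : Type u} [AddCommGroup M] [Module.Free ℤ M] (B : BilinForm ℤ M)

/-- **(refldiv) `r² ∣ 2 div(r)`** for a primitive reflective `r`: from `(r,r)·σ_r(r') = (r,r)·r' − 2(r',r)·r` with
`(r, r') = d`, `2d·r ∈ (r,r)·L`, and primitivity of `r` gives `(r,r) ∣ 2d`.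
[cite: GritsenkoHulekSankaran2007Kodaira, §4 (arXiv numbering) eq. (refldiv) ("`div(r) ∣ r² ∣ 2 div(r)`")] -/
theorem apply_self_dvd_two_mul_of_reflection (hs : B.IsSymm) {r : M} (hr : B r r ≠ 0)
    (hsat : ∀ (k : ℤ) (w : M), k ≠ 0 → k • w ∈ ℤ ∙ r → w ∈ ℤ ∙ r) (g : B.IsometryEquiv B)
    (hg : ∀ l, B r r • g l = B r r • l - (2 * B l r) • r) {r' : M} {d : ℤ} (hd : B r r' = d) : B r r ∣ 2 * d := by
  have hr0 : r ≠ 0 := fun h ↦ hr (by simp [h])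
  have h1 : B r r • (r' - g r') = (2 * d) • r := by
    rw [smul_sub, hg r', hs.eq r' r, hd]
    abel
  have hmem : B r r • (r' - g r') ∈ ℤ ∙ r := by
    rw [h1]
    exact Submodule.smul_mem _ _ (Submodule.mem_span_singleton_self r)
  obtain ⟨c, hc⟩ := Submodule.mem_span_singleton.1 (hsat _ _ hr hmem)
  refine ⟨c, smul_left_injective ℤ hr0 ?_⟩
  change (2 * d) • r = (B r r * c) • r
  rw [← h1, ← hc, smul_smul, mul_comm]

/-- **(refldiv) as a factorisation: `r² = c·div(r)` with `c·c' = 2`** (`c ∈ {±1, ±2}`): `div(r) ∣ r²` because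
`r² ∈ (r, L) = div(r)ℤ`, and `r² ∣ 2div(r)` forces the cofactor `c` to divide `2`. The two cases `c = ±1`
(`div(r) = |r²|`) and `c = ±2` (`2div(r) = |r²|`) organise Prop. 4.2.
[cite: GritsenkoHulekSankaran2007Kodaira, §4 (arXiv numbering) eq. (refldiv) ("`div(r) ∣ r² ∣ 2 div(r)`")] -/
theorem exists_mul_eq_two_and_apply_self_eq_mul_divisor (hs : B.IsSymm) {r : M} (hr : B r r ≠ 0)
    (hsat : ∀ (k : ℤ) (w : M), k ≠ 0 → k • w ∈ ℤ ∙ r → w ∈ ℤ ∙ r) (g : B.IsometryEquiv B)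
    (hg : ∀ l, B r r • g l = B r r • l - (2 * B l r) • r) {r' : M} {d : ℤ} (hdvd : ∀ z, d ∣ B r z)
    (hd : B r r' = d) : ∃ c c' : ℤ, c * c' = 2 ∧ B r r = c * d := by
  obtain ⟨c, hc⟩ := hdvd r
  obtain ⟨m, hm⟩ := apply_self_dvd_two_mul_of_reflection B hs hr hsat g hg hd
  have hd0 : d ≠ 0 := by
    rintro rfl
    exact hr (by rw [hc, zero_mul])
  refine ⟨c, m, ?_, by rw [hc, mul_comm]⟩
  have h : d * (c * m) = d * 2 := by rw [← mul_assoc, ← hc, ← hm, mul_comm]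
  exact mul_left_cancel₀ hd0 h

omit [Module.Free ℤ M] in
/-- `c·c' = 2` over `ℤ` means `(c, c') ∈ {(1,2), (2,1), (−1,−2), (−2,−1)}`. [folklore] -/
private theorem eq_of_mul_eq_two {c c' : ℤ} (h : c * c' = 2) :
    (c = 1 ∧ c' = 2) ∨ (c = -1 ∧ c' = -2) ∨ (c = 2 ∧ c' = 1) ∨ (c = -2 ∧ c' = -1) := by
  have hc : c ∣ 2 := ⟨c', h.symm⟩
  have h1 := Int.le_of_dvd (by norm_num) hc
  have h2 := Int.le_of_dvd (by norm_num) ((neg_dvd).2 hc)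
  have hc0 : c ≠ 0 := by rintro rfl; simp at h
  have h3 : -2 ≤ c := by omega
  interval_cases c <;> omega

omit [Module.Free ℤ M] in
/-- **`r*(r) = c`**: for `r* = f` with `d•f = (r, ·)` and `r² = c·d` (`d ≠ 0`), `f(r) = r²/div(r) = c`.
[cite: GritsenkoHulekSankaran2007Kodaira, §4 (arXiv numbering) ("`l* = l/div(l)`")] -/
theorem dual_apply_self_eq_of_smul_eq {r : M} {d c : ℤ} (hd0 : d ≠ 0) {f : Module.Dual ℤ M} (hf : d • f = B r)
    (hc : B r r = c * d) : f r = c := by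
  have h := LinearMap.congr_fun hf r
  rw [LinearMap.smul_apply, smul_eq_mul, hc, mul_comm c] at h
  exact mul_left_cancel₀ hd0 h

/-- **`σ_r(l) = l − c'·r*(l)·r`** (`= l − (2(l,r)/r²) r` with `2(l,r)/r² = 2d·f(l)/(c·d) = c'·f(l)`): the integral form
of the printed reflection formula, for `r² = c·d`, `c·c' = 2`, `d•f = (r,·)`.
[cite: GritsenkoHulekSankaran2007Kodaira, §4 (arXiv numbering) ("`σ_r : l ↦ l − (2(l,r)/(r,r)) r`")] -/
theorem reflection_apply_eq_sub_smul (hs : B.IsSymm) {r : M} (hr : B r r ≠ 0)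
    (g : B.IsometryEquiv B) (hg : ∀ l, B r r • g l = B r r • l - (2 * B l r) • r) {d c c' : ℤ} (hcc' : c * c' = 2)
    (hc : B r r = c * d) {f : Module.Dual ℤ M} (hf : d • f = B r) (l : M) : g l = l - (c' * f l) • r := by
  refine smul_right_injective M hr ?_
  change B r r • g l = B r r • (l - (c' * f l) • r)
  have hl : B l r = d * f l := by
    rw [← hs.eq r l, ← hf, LinearMap.smul_apply, smul_eq_mul]
  rw [hg l, hl, smul_sub, smul_smul, hc,
    show 2 * (d * f l) = c * d * (c' * f l) by linear_combination (d * f l) * hcc'.symm]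

/-- **`σ_r^* φ = φ − c'·φ(r)·r*`**: the action on `L^∨`, `(φ ∘ σ_r)(l) = φ(l) − c'·f(l)·φ(r)`.
[cite: GritsenkoHulekSankaran2007Kodaira, §4 (arXiv numbering) Prop. 4.2 proof, condition (−id)] -/
theorem symm_dualMap_eq_of_reflection (hs : B.IsSymm) {r : M} (hr : B r r ≠ 0)
    (g : B.IsometryEquiv B) (hg : ∀ l, B r r • g l = B r r • l - (2 * B l r) • r) {d c c' : ℤ} (hcc' : c * c' = 2)
    (hc : B r r = c * d) {f : Module.Dual ℤ M} (hf : d • f = B r) (φ : Module.Dual ℤ M) :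
    (g : M ≃ₗ[ℤ] M).symm.dualMap φ = φ - (c' * φ r) • f := by
  refine LinearMap.ext fun l ↦ ?_
  rw [LinearEquiv.dualMap_apply, reflection_symm_apply B hr g hg,
    reflection_apply_eq_sub_smul B hs hr g hg hcc' hc hf, map_sub, map_smul, LinearMap.sub_apply,
    LinearMap.smul_apply, smul_eq_mul, smul_eq_mul]
  ring

end Reflective

/-! ### §2 `−σ_r ∈ Õ(L)` as a condition on `L^∨`: `2[φ] = c'·φ(r)·[r*]` for all `φ` -/

section Condition

variable {M : Type u} [AddCommGroup M] (B : BilinForm ℤ M)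

/-- `n • [f] = [n • f]` in `A_L = L^∨/L` (the integer action on the quotient versus on `L^∨`). [folklore] -/
private theorem zsmul_mk (f : Module.Dual ℤ M) (n : ℤ) :
    (n • (Submodule.Quotient.mk f : B.discriminantGroup)) = Submodule.Quotient.mk (n • f) :=
  (Submodule.Quotient.mk_smul _ _ _).symm

/-- **"`−σ_r ∈ Õ(L)`, i.e. `σ_r|_{A_L} = −id`"**: for any `g ∈ O(L)`, `((−1) ∘ g)‾ = id` iff `ḡ a = −a` for all
`a ∈ A_L` (`(−1)‾ = −1`). [cite: GritsenkoHulekSankaran2007Kodaira, §4 (arXiv numbering) Prop. 4.2 ("`−σ_r ∈ Õ(L)`, i.e. `σ_r|_{A_L} = −id`")] -/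
theorem forall_discriminantGroupCongr_eq_neg_iff (g : B.IsometryEquiv B) :
    (∀ a, g.discriminantGroupCongr a = -a) ↔
      ((LinearMap.BilinForm.IsometryEquiv.neg B).trans g).discriminantGroupCongr =
        LinearEquiv.refl ℤ B.discriminantGroup := by
  rw [IsometryEquiv.discriminantGroupCongr_trans]
  refine ⟨fun h ↦ LinearEquiv.ext fun a ↦ ?_, fun h a ↦ ?_⟩
  · rw [LinearEquiv.trans_apply, discriminantGroupCongr_neg_apply, map_neg, h, neg_neg, LinearEquiv.refl_apply]
  · have h1 := LinearEquiv.congr_fun h (-a)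
    rw [LinearEquiv.trans_apply, discriminantGroupCongr_neg_apply, neg_neg, LinearEquiv.refl_apply] at h1
    exact h1

/-- **Condition (−id) on `L^∨`: `−σ_r ∈ Õ(L)` iff `2[φ] = c'·φ(r)·[r*]` in `A_L` for every `φ ∈ L^∨`** — the
printed "`2l^∨ ≡ (2(r, l^∨)/r²) r mod L` for all `l^∨ ∈ L^∨`" (`(2(r,l^∨)/r²) r = c'·φ(r)·r*` for `φ = (l^∨, ·)`).
[cite: GritsenkoHulekSankaran2007Kodaira, §4 (arXiv numbering) Prop. 4.2 proof, condition (−id)] -/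
theorem forall_discriminantGroupCongr_eq_neg_iff_mk [Module.Free ℤ M] (hs : B.IsSymm) {r : M}
    (hr : B r r ≠ 0) (g : B.IsometryEquiv B) (hg : ∀ l, B r r • g l = B r r • l - (2 * B l r) • r) {d c c' : ℤ}
    (hcc' : c * c' = 2) (hc : B r r = c * d) {f : Module.Dual ℤ M} (hf : d • f = B r) :
    (∀ a, g.discriminantGroupCongr a = -a) ↔
      ∀ φ : Module.Dual ℤ M, (2 : ℤ) • (Submodule.Quotient.mk φ : B.discriminantGroup) =
        (c' * φ r) • Submodule.Quotient.mk f := by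
  constructor
  · intro h φ
    have h1 := h (Submodule.Quotient.mk φ)
    rw [IsometryEquiv.discriminantGroupCongr_mk, symm_dualMap_eq_of_reflection B hs hr g hg hcc' hc hf,
      Submodule.Quotient.mk_sub, ← zsmul_mk] at h1
    have h2 : (Submodule.Quotient.mk φ : B.discriminantGroup) + Submodule.Quotient.mk φ -
        (c' * φ r) • Submodule.Quotient.mk f = 0 := by
      rw [add_sub_assoc, h1, add_neg_cancel]
    rw [two_smul]
    exact sub_eq_zero.1 h2
  · intro h a
    obtain ⟨φ, rfl⟩ := B.discriminantGroup_mk_surjective a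
    rw [IsometryEquiv.discriminantGroupCongr_mk, symm_dualMap_eq_of_reflection B hs hr g hg hcc' hc hf,
      Submodule.Quotient.mk_sub, ← zsmul_mk, ← h φ, two_smul]
    abel

end Condition

/-! ### §3a Finite abelian groups generated by one element together with the `2`-torsion -/

section TwoTorsion

variable {A : Type u} [AddCommGroup A] [Finite A]

/-- In a finite cyclic subgroup `ℤa`, an element of the same order generates: `b ∈ ℤa`, `ord b = ord a ⟹ ℤb = ℤa`
(a cyclic group of order `n` has a unique subgroup of each order dividing `n`).
[cite: DummitFoote2004, §2.3 Thm. 7 (3) ("for each divisor `a` of `n` there is a unique subgroup of `H` of order `a`")] -/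
theorem zmultiples_eq_of_mem_of_addOrderOf_eq {a b : A} (hb : b ∈ AddSubgroup.zmultiples a)
    (h : addOrderOf b = addOrderOf a) : AddSubgroup.zmultiples b = AddSubgroup.zmultiples a :=
  AddSubgroup.eq_of_le_of_card_ge (AddSubgroup.zmultiples_le.2 hb)
    (by rw [Nat.card_zmultiples, Nat.card_zmultiples, h])

omit [Finite A] in
/-- `ord(2x) = ord(x)/gcd(ord x, 2)` — "if `|x| = n < ∞`, then `|x^a| = n/(n, a)`" at `a = 2`, additively.
[cite: DummitFoote2004, §2.3 Prop. 5 (2)] -/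
theorem addOrderOf_two_zsmul (x : A) : addOrderOf ((2 : ℤ) • x) = addOrderOf x / Nat.gcd (addOrderOf x) 2 := by
  rw [ofNat_zsmul, addOrderOf_nsmul' x two_ne_zero]

omit [Finite A] in
/-- If `A = ℤx + A[2]` (every element is a multiple of `x` plus a `2`-torsion element), the exponent of `A` ("the
smallest positive integer `n` such that `x^n = 1` for all `x ∈ G`") divides `2·ord(x)` — GHS's "Thus `D` divides `2e`".
[cite: GritsenkoHulekSankaran2007Kodaira, §4 (arXiv numbering) Prop. 4.2 proof of (i) ("Thus `D` divides `2e`")] [cite: DummitFoote2004, §5.2 Definition (2) (exponent)] -/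
theorem exponent_dvd_two_mul_addOrderOf_of_forall_eq_zsmul_add {x : A}
    (hgen : ∀ a : A, ∃ (k : ℤ) (t : A), (2 : ℤ) • t = 0 ∧ a = k • x + t) :
    AddMonoid.exponent A ∣ 2 * addOrderOf x := by
  have h : ((AddMonoid.exponent A : ℕ) : ℤ) ∣ ((2 * addOrderOf x : ℕ) : ℤ) := by
    rw [AddGroup.exponent_dvd_iff_forall_zsmul_eq_zero]
    intro a
    obtain ⟨k, t, ht, rfl⟩ := hgen a
    have hx : (addOrderOf x : ℤ) • x = 0 := by
      rw [natCast_zsmul]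
      exact addOrderOf_nsmul_eq_zero x
    rw [smul_add, smul_smul, Nat.cast_mul, Nat.cast_ofNat, show (2 * (addOrderOf x : ℤ) * k) = (2 * k) * addOrderOf x by
      ring, mul_smul, hx, smul_zero, zero_add, mul_comm, mul_smul, ht, smul_zero]
  exact Int.natCast_dvd_natCast.1 h

omit [Finite A] in
/-- If `A = ℤx + A[2]` with `ord(x)` even, the exponent of `A` is `ord(x)` (GHS's "`e ∣ D ∣ 2e`" bookkeeping).
[cite: GritsenkoHulekSankaran2007Kodaira, §4 (arXiv numbering) Prop. 4.2 proof of (i) ("`e ∣ div(r) ∣ 2e` and `e ∣ D ∣ 2e`")] [cite: DummitFoote2004, §5.2 Definition (2) (exponent)] -/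
theorem exponent_eq_addOrderOf_of_forall_eq_zsmul_add_of_even {x : A}
    (hgen : ∀ a : A, ∃ (k : ℤ) (t : A), (2 : ℤ) • t = 0 ∧ a = k • x + t) (hev : Even (addOrderOf x)) :
    AddMonoid.exponent A = addOrderOf x := by
  refine Nat.dvd_antisymm ?_ (AddMonoid.addOrder_dvd_exponent x)
  obtain ⟨j, hj⟩ := hev
  have h : ((AddMonoid.exponent A : ℕ) : ℤ) ∣ ((addOrderOf x : ℕ) : ℤ) := by
    rw [AddGroup.exponent_dvd_iff_forall_zsmul_eq_zero]
    intro a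
    obtain ⟨k, t, ht, rfl⟩ := hgen a
    have hx : (addOrderOf x : ℤ) • x = 0 := by
      rw [natCast_zsmul]
      exact addOrderOf_nsmul_eq_zero x
    rw [smul_add, smul_smul, mul_comm, mul_smul, hx, smul_zero, zero_add, hj, Nat.cast_add, ← two_mul, mul_comm,
      mul_smul, ht, smul_zero]
  exact Int.natCast_dvd_natCast.1 h

/-- **`A = ℤa₀ + A[2]` for some `a₀` ⟹ `A = ℤx + A[2]` for an `x` of maximal order `ord(x) = exp(A)`**: take any `x`
of order `exp(A)` (it exists in a finite abelian group); then `2x` and `2a₀` generate the same cyclic group, so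
`a₀ ∈ ℤx + A[2]` — the step "`(2L^∨)/L` is a subgroup of the cyclic group generated by `(r/D)+L` or `(2r/D)+L`.
This implies (ii)" made abstract. [cite: GritsenkoHulekSankaran2007Kodaira, §4 (arXiv numbering) Prop. 4.2 proof of (i)–(ii)] [cite: DummitFoote2004, §2.3 Thm. 7 (3), §5.2 Definition (2)] -/
theorem exists_addOrderOf_eq_exponent_of_forall_eq_zsmul_add {a₀ : A}
    (hgen : ∀ a : A, ∃ (k : ℤ) (t : A), (2 : ℤ) • t = 0 ∧ a = k • a₀ + t) :
    ∃ x : A, addOrderOf x = AddMonoid.exponent A ∧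
      ∀ a : A, ∃ (k : ℤ) (t : A), (2 : ℤ) • t = 0 ∧ a = k • x + t := by
  obtain ⟨y, hy⟩ := AddMonoid.exists_addOrderOf_eq_exponent (AddMonoid.ExponentExists.of_finite (G := A))
  refine ⟨y, hy, ?_⟩
  have hD := exponent_dvd_two_mul_addOrderOf_of_forall_eq_zsmul_add hgen
  have hn₀ : addOrderOf a₀ ∣ AddMonoid.exponent A := AddMonoid.addOrder_dvd_exponent a₀
  have hpos : 0 < addOrderOf a₀ := addOrderOf_pos a₀
  -- `ord(2y) = ord(2a₀)`
  have h2 : addOrderOf ((2 : ℤ) • y) = addOrderOf ((2 : ℤ) • a₀) := by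
    rw [addOrderOf_two_zsmul, addOrderOf_two_zsmul, hy]
    rcases Nat.even_or_odd (addOrderOf a₀) with hev | hodd
    · rw [exponent_eq_addOrderOf_of_forall_eq_zsmul_add_of_even hgen hev]
    · obtain ⟨m, hm⟩ := hn₀
      have hm2 : m ∣ 2 := by
        have h1 : addOrderOf a₀ * m ∣ addOrderOf a₀ * 2 := by rw [← hm, mul_comm]; exact hD
        exact Nat.dvd_of_mul_dvd_mul_left hpos h1
      have hm12 : m = 1 ∨ m = 2 := by
        have := Nat.le_of_dvd two_pos hm2
        interval_cases m <;> simp_all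
      rcases hm12 with rfl | rfl
      · rw [hm, mul_one]
      · rw [hm, Nat.gcd_mul_left_left, Nat.mul_div_cancel _ two_pos,
          Nat.Coprime.gcd_eq_one (Nat.coprime_two_right.2 hodd), Nat.div_one]
  -- `2y ∈ ℤ(2a₀)`, hence `ℤ(2y) = ℤ(2a₀) ∋ 2a₀`
  obtain ⟨k, t, ht, hyk⟩ := hgen y
  have hmem : (2 : ℤ) • y ∈ AddSubgroup.zmultiples ((2 : ℤ) • a₀) := by
    rw [hyk, smul_add, ht, add_zero, smul_comm]
    exact AddSubgroup.zsmul_mem _ (AddSubgroup.mem_zmultiples _) k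
  have heq := zmultiples_eq_of_mem_of_addOrderOf_eq hmem h2
  obtain ⟨m, hm⟩ := AddSubgroup.mem_zmultiples_iff.1 (heq ▸ AddSubgroup.mem_zmultiples ((2 : ℤ) • a₀) :
    (2 : ℤ) • a₀ ∈ AddSubgroup.zmultiples ((2 : ℤ) • y))
  have h0 : (2 : ℤ) • (a₀ - m • y) = 0 := by rw [smul_sub, ← hm, smul_comm, sub_self]
  intro a
  obtain ⟨k', t', ht', rfl⟩ := hgen a
  refine ⟨k' * m, k' • (a₀ - m • y) + t', ?_, ?_⟩
  · rw [smul_add, smul_comm, h0, smul_zero, zero_add, ht']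
  · rw [smul_sub, mul_smul, smul_comm k' m y]
    abel

omit [Finite A] in
/-- In a group of odd exponent the `2`-torsion vanishes (the order of a `2`-torsion element divides `gcd(2, exp) = 1`);
GHS (iv): "`D` is odd and the group `A_L` is cyclic". [cite: GritsenkoHulekSankaran2007Kodaira, §4 (arXiv numbering) Prop. 4.2 proof of (iv)] [cite: DummitFoote2004, §5.2 Definition (2) (exponent)] -/
theorem eq_zero_of_two_zsmul_eq_zero_of_odd_exponent (hodd : Odd (AddMonoid.exponent A)) {t : A}
    (ht : (2 : ℤ) • t = 0) : t = 0 := by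
  have h1 : addOrderOf t ∣ 2 := by exact_mod_cast addOrderOf_dvd_iff_zsmul_eq_zero.2 ht
  have h2 : addOrderOf t ∣ Nat.gcd 2 (AddMonoid.exponent A) := Nat.dvd_gcd h1 (AddMonoid.addOrder_dvd_exponent t)
  rw [Nat.Coprime.gcd_eq_one (Nat.coprime_two_left.2 hodd), Nat.dvd_one] at h2
  exact AddMonoid.addOrderOf_eq_one_iff.1 h2

/-- `n ∣ D ∣ 2n`, `n ≠ 0 ⟹ D = n ∨ D = 2n`. [folklore] -/
private theorem eq_or_eq_two_mul_of_dvd_of_dvd {n D : ℕ} (hn : n ≠ 0) (h1 : n ∣ D) (h2 : D ∣ 2 * n) :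
    D = n ∨ D = 2 * n := by
  obtain ⟨m, rfl⟩ := h1
  have hm2 : m ∣ 2 := Nat.dvd_of_mul_dvd_mul_left (Nat.pos_of_ne_zero hn) (by rw [mul_comm 2 n] at h2; exact h2)
  have := Nat.le_of_dvd two_pos hm2
  interval_cases m <;> simp_all [mul_comm]

end TwoTorsion

/-! ### §3 Necessity: the structure of `A_L` when `−σ_r ∈ Õ(L)`; Prop. 4.2 (i) and (ii) -/

section Necessity

variable {M : Type u} [AddCommGroup M] [Module.Free ℤ M] (B : BilinForm ℤ M)

/-- **Case `div(r) = |r²|` (`c = ±1`): `−σ_r ∈ Õ(L) ⟹ A_L = ℤ[r*] + A_L[2]`** — every class is a multiple of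
`[r*]` plus a `2`-torsion class (`2[φ] = ±2φ(r)[r*]`). This is the printed "`(2L^∨)/L` is a subgroup of the cyclic
group generated by `2r* + L`". [cite: GritsenkoHulekSankaran2007Kodaira, §4 (arXiv numbering) Prop. 4.2 proof of (i)–(ii) ("`(2L^∨)/L` is a subgroup of the cyclic group generated by `(r/D)+L` or `(2r/D)+L`")] -/
theorem forall_eq_zsmul_mk_add_of_discriminantGroupCongr_eq_neg (hs : B.IsSymm) {r : M} (hr : B r r ≠ 0)
    (g : B.IsometryEquiv B) (hg : ∀ l, B r r • g l = B r r • l - (2 * B l r) • r) {d c c' : ℤ} (hcc' : c * c' = 2)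
    (hc : B r r = c * d) (hc1 : c = 1 ∨ c = -1) {f : Module.Dual ℤ M} (hf : d • f = B r)
    (hneg : ∀ a, g.discriminantGroupCongr a = -a) :
    ∀ a : B.discriminantGroup, ∃ (k : ℤ) (t : B.discriminantGroup),
      (2 : ℤ) • t = 0 ∧ a = k • Submodule.Quotient.mk f + t := by
  have hc' : c' = 2 * c := by rcases hc1 with rfl | rfl <;> linarith
  rw [forall_discriminantGroupCongr_eq_neg_iff_mk B hs hr g hg hcc' hc hf] at hneg
  intro a
  obtain ⟨φ, rfl⟩ := B.discriminantGroup_mk_surjective a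
  refine ⟨c * φ r, Submodule.Quotient.mk φ - (c * φ r) • Submodule.Quotient.mk f, ?_, by abel⟩
  rw [zsmul_sub, hneg φ, hc', smul_smul, mul_assoc, sub_self]

/-- **Case `2div(r) = |r²|` (`c = ±2`): `−σ_r ∈ Õ(L) ⟹ 2A_L ⊆ ℤ[r*]`** (`2[φ] = ±φ(r)[r*]`): the printed
"`(2L^∨)/L` is a subgroup of the cyclic group `⟨(r/e)+L⟩`", `r/e = ±r*`.
[cite: GritsenkoHulekSankaran2007Kodaira, §4 (arXiv numbering) Prop. 4.2 proof of (i) ("`(2L^∨)/L` is a subgroup of the cyclic group `⟨(r/e)+L⟩`")] -/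
theorem two_zsmul_mem_zmultiples_mk_of_discriminantGroupCongr_eq_neg (hs : B.IsSymm) {r : M} (hr : B r r ≠ 0)
    (g : B.IsometryEquiv B) (hg : ∀ l, B r r • g l = B r r • l - (2 * B l r) • r) {d c c' : ℤ} (hcc' : c * c' = 2)
    (hc : B r r = c * d) {f : Module.Dual ℤ M} (hf : d • f = B r) (hneg : ∀ a, g.discriminantGroupCongr a = -a)
    (a : B.discriminantGroup) : ∃ k : ℤ, (2 : ℤ) • a = k • Submodule.Quotient.mk f := by
  rw [forall_discriminantGroupCongr_eq_neg_iff_mk B hs hr g hg hcc' hc hf] at hneg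
  obtain ⟨φ, rfl⟩ := B.discriminantGroup_mk_surjective a
  exact ⟨c' * φ r, hneg φ⟩

/-- **Case `2div(r) = |r²|` (`c = ±2`): `−σ_r ∈ Õ(L) ⟹ A_L = ℤ[φ₀] + A_L[2]`** for any `φ₀ ∈ L^∨` with `φ₀(r) = 1`
(`2[φ₀] = ±[r*]`, `2([φ] − φ(r)[φ₀]) = 0`). [cite: GritsenkoHulekSankaran2007Kodaira, §4 (arXiv numbering) Prop. 4.2 proof of (i)–(ii)] -/
theorem forall_eq_zsmul_mk_add_of_discriminantGroupCongr_eq_neg_of_apply_eq_one (hs : B.IsSymm) {r : M}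
    (hr : B r r ≠ 0) (g : B.IsometryEquiv B) (hg : ∀ l, B r r • g l = B r r • l - (2 * B l r) • r) {d c c' : ℤ}
    (hcc' : c * c' = 2) (hc : B r r = c * d) {f : Module.Dual ℤ M} (hf : d • f = B r)
    (hneg : ∀ a, g.discriminantGroupCongr a = -a) {φ₀ : Module.Dual ℤ M} (hφ₀ : φ₀ r = 1) :
    ∀ a : B.discriminantGroup, ∃ (k : ℤ) (t : B.discriminantGroup),
      (2 : ℤ) • t = 0 ∧ a = k • Submodule.Quotient.mk φ₀ + t := by
  rw [forall_discriminantGroupCongr_eq_neg_iff_mk B hs hr g hg hcc' hc hf] at hneg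
  have h0 : (2 : ℤ) • (Submodule.Quotient.mk φ₀ : B.discriminantGroup) = c' • Submodule.Quotient.mk f := by
    rw [hneg φ₀, hφ₀, mul_one]
  intro a
  obtain ⟨φ, rfl⟩ := B.discriminantGroup_mk_surjective a
  refine ⟨φ r, Submodule.Quotient.mk φ - φ r • Submodule.Quotient.mk φ₀, ?_, by abel⟩
  rw [zsmul_sub, hneg φ, smul_comm, h0, smul_smul, mul_comm, sub_self]

variable [Module.Finite ℤ M]

/-- **Case `div(r) = |r²|`: `D = div(r)`** (`A_L = ℤ[r*] + A_L[2]`, `ord[r*] = div(r)` even).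
[cite: GritsenkoHulekSankaran2007Kodaira, §4 (arXiv numbering) Prop. 4.2 (i) ("`r² = ±D` and `div(r) = D`")] -/
theorem exponent_eq_divisor_of_discriminantGroupCongr_eq_neg (hB : B.Nondegenerate) (hs : B.IsSymm) (he : B.IsEven)
    {r : M} (hr : B r r ≠ 0) (hsat : ∀ (k : ℤ) (w : M), k ≠ 0 → k • w ∈ ℤ ∙ r → w ∈ ℤ ∙ r)
    (g : B.IsometryEquiv B) (hg : ∀ l, B r r • g l = B r r • l - (2 * B l r) • r) {d c c' : ℤ} (hd : 0 < d)
    (hcc' : c * c' = 2) (hc : B r r = c * d) (hc1 : c = 1 ∨ c = -1) {f : Module.Dual ℤ M} (hf : d • f = B r)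
    (hneg : ∀ a, g.discriminantGroupCongr a = -a) : (AddMonoid.exponent B.discriminantGroup : ℤ) = d := by
  haveI := finite_discriminantGroup B hB
  have hr0 : r ≠ 0 := fun h ↦ hr (by simp [h])
  have hgen := forall_eq_zsmul_mk_add_of_discriminantGroupCongr_eq_neg B hs hr g hg hcc' hc hc1 hf hneg
  have hord := addOrderOf_mk_eq_natAbs_of_primitive hB hd.ne' hf hr0 hsat
  have hev : Even (addOrderOf (Submodule.Quotient.mk f : B.discriminantGroup)) := by
    rw [hord, Int.natAbs_even]
    obtain ⟨k, hk⟩ := he r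
    rcases hc1 with rfl | rfl
    · exact ⟨k, by linarith⟩
    · exact ⟨-k, by linarith⟩
  rw [exponent_eq_addOrderOf_of_forall_eq_zsmul_add_of_even hgen hev, hord, Int.natCast_natAbs, abs_of_pos hd]

/-- **Case `2div(r) = |r²|`: `div(r) ∣ D ∣ 2div(r)`, and `D = div(r)` only for odd `div(r)`** (`A_L = ℤ[φ₀] + A_L[2]`
with `2[φ₀] = ±[r*]`, `ord[r*] = div(r)`). [cite: GritsenkoHulekSankaran2007Kodaira, §4 (arXiv numbering) Prop. 4.2 (i) ("`e ∣ D ∣ 2e`", "`div(r) = D ≡ 1 mod 2`, or … `div(r) = D/2`")] -/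
theorem exponent_eq_or_of_discriminantGroupCongr_eq_neg (hB : B.Nondegenerate) (hs : B.IsSymm) {r : M}
    (hr : B r r ≠ 0) (hsat : ∀ (k : ℤ) (w : M), k ≠ 0 → k • w ∈ ℤ ∙ r → w ∈ ℤ ∙ r) (g : B.IsometryEquiv B)
    (hg : ∀ l, B r r • g l = B r r • l - (2 * B l r) • r) {d c c' : ℤ} (hd : 0 < d) (hcc' : c * c' = 2)
    (hc : B r r = c * d) (hc2 : c = 2 ∨ c = -2) {f : Module.Dual ℤ M} (hf : d • f = B r)
    (hneg : ∀ a, g.discriminantGroupCongr a = -a) :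
    ((AddMonoid.exponent B.discriminantGroup : ℤ) = d ∧ Odd d) ∨ (AddMonoid.exponent B.discriminantGroup : ℤ) = 2 * d := by
  haveI := finite_discriminantGroup B hB
  have hr0 : r ≠ 0 := fun h ↦ hr (by simp [h])
  have hc' : c' = 1 ∨ c' = -1 := by rcases hc2 with rfl | rfl <;> [left; right] <;> linarith
  obtain ⟨φ₀, hφ₀⟩ := exists_dual_apply_eq_one_of_primitive hr0 hsat
  have hgen := forall_eq_zsmul_mk_add_of_discriminantGroupCongr_eq_neg_of_apply_eq_one B hs hr g hg hcc' hc hf hneg hφ₀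
  have hord := addOrderOf_mk_eq_natAbs_of_primitive hB hd.ne' hf hr0 hsat
  have h0 : (2 : ℤ) • (Submodule.Quotient.mk φ₀ : B.discriminantGroup) = c' • Submodule.Quotient.mk f := by
    rw [(forall_discriminantGroupCongr_eq_neg_iff_mk B hs hr g hg hcc' hc hf).1 hneg φ₀, hφ₀, mul_one]
  have hdf : d • (Submodule.Quotient.mk f : B.discriminantGroup) = 0 := by
    rw [zsmul_mk, hf]
    exact B.discriminantGroup_mk_apply r
  -- `D ∣ 2d`
  have hD2 : ((AddMonoid.exponent B.discriminantGroup : ℕ) : ℤ) ∣ 2 * d := by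
    rw [AddGroup.exponent_dvd_iff_forall_zsmul_eq_zero]
    intro a
    obtain ⟨k, t, ht, rfl⟩ := hgen a
    rw [zsmul_add, smul_smul, show 2 * d * k = (k * d) * 2 by ring, mul_smul, h0, smul_smul,
      show k * d * c' = (k * c') * d by ring, mul_smul, hdf, zsmul_zero, zero_add, mul_comm, mul_smul, ht, zsmul_zero]
  -- `d ∣ D`
  have hdD : d.natAbs ∣ AddMonoid.exponent B.discriminantGroup := hord ▸ AddMonoid.addOrder_dvd_exponent _
  have hd' : (d.natAbs : ℤ) = d := by rw [Int.natCast_natAbs, abs_of_pos hd]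
  have hD2' : AddMonoid.exponent B.discriminantGroup ∣ 2 * d.natAbs := by
    rw [← Int.natCast_dvd_natCast, Nat.cast_mul, hd', Nat.cast_ofNat]
    exact hD2
  rcases eq_or_eq_two_mul_of_dvd_of_dvd (Int.natAbs_ne_zero.2 hd.ne') hdD hD2' with h | h
  · refine Or.inl ⟨by rw [h, hd'], ?_⟩
    -- `D = d` forces `d` odd: otherwise `d•[φ₀] = (d/2)•2[φ₀] = ±(d/2)•[r*] ≠ 0`
    by_contra hodd
    rw [Int.not_odd_iff_even] at hodd
    obtain ⟨j, hj⟩ := hodd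
    have h1 : d • (Submodule.Quotient.mk φ₀ : B.discriminantGroup) = 0 := by
      rw [← hd', ← h, natCast_zsmul]
      exact AddMonoid.exponent_nsmul_eq_zero _
    rw [hj, ← two_mul, mul_comm, mul_smul, h0, smul_smul, zsmul_mk,
      zsmul_mk_eq_zero_iff_dvd_of_primitive hB hd.ne' hf hr0 hsat] at h1
    have h2 : (j + j).natAbs ∣ (j * c').natAbs := Int.natAbs_dvd_natAbs.2 (hj ▸ h1)
    rw [Int.natAbs_mul, show c'.natAbs = 1 by rcases hc' with rfl | rfl <;> rfl, mul_one] at h2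
    have h3 := Nat.le_of_dvd (Int.natAbs_pos.2 (by rintro rfl; simp at hj; omega)) h2
    omega
  · exact Or.inr (by rw [h, Nat.cast_mul, hd', Nat.cast_ofNat])

/-- **GHS Prop. 4.2 (i), as printed.** Let `L` be a nondegenerate even lattice, `r ∈ L` primitive and reflective with
divisor `d = div(r)`, `D` the exponent of `A_L`. If `−σ_r ∈ Õ(L)` (`σ̄_r = −id`), then `r² = ±2D` and `div(r) = D`
is odd, or `r² = ±D` and `div(r) = D` or `D/2`.
[cite: GritsenkoHulekSankaran2007Kodaira, §4 (arXiv numbering) Prop. 4.2 (i) ("`r² = ±2D` and `div(r) = D ≡ 1 mod 2`, or `r² = ±D` and `div(r) = D` or `D/2`")] -/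
theorem apply_self_eq_and_divisor_eq_exponent_of_discriminantGroupCongr_eq_neg (hB : B.Nondegenerate)
    (hs : B.IsSymm) (he : B.IsEven) {r : M} (hr : B r r ≠ 0)
    (hsat : ∀ (k : ℤ) (w : M), k ≠ 0 → k • w ∈ ℤ ∙ r → w ∈ ℤ ∙ r) (g : B.IsometryEquiv B)
    (hg : ∀ l, B r r • g l = B r r • l - (2 * B l r) • r) {d : ℤ} (hd : 0 < d) (hdvd : ∀ z, d ∣ B r z) {r' : M}
    (hr' : B r r' = d) (hneg : ∀ a, g.discriminantGroupCongr a = -a) :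
    ((B r r = 2 * AddMonoid.exponent B.discriminantGroup ∨ B r r = -(2 * AddMonoid.exponent B.discriminantGroup)) ∧
        d = AddMonoid.exponent B.discriminantGroup ∧ Odd (AddMonoid.exponent B.discriminantGroup)) ∨
      ((B r r = AddMonoid.exponent B.discriminantGroup ∨ B r r = -(AddMonoid.exponent B.discriminantGroup : ℤ)) ∧
        (d = AddMonoid.exponent B.discriminantGroup ∨ 2 * d = AddMonoid.exponent B.discriminantGroup)) := by
  obtain ⟨c, c', hcc', hc⟩ := exists_mul_eq_two_and_apply_self_eq_mul_divisor B hs hr hsat g hg hdvd hr'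
  obtain ⟨f, hf⟩ := exists_dual_smul_eq_of_forall_dvd B hdvd
  rcases eq_of_mul_eq_two hcc' with ⟨rfl, rfl⟩ | ⟨rfl, rfl⟩ | ⟨rfl, rfl⟩ | ⟨rfl, rfl⟩
  · have hD := exponent_eq_divisor_of_discriminantGroupCongr_eq_neg B hB hs he hr hsat g hg hd hcc' hc
      (Or.inl rfl) hf hneg
    exact Or.inr ⟨Or.inl (by rw [hc, hD, one_mul]), Or.inl hD.symm⟩
  · have hD := exponent_eq_divisor_of_discriminantGroupCongr_eq_neg B hB hs he hr hsat g hg hd hcc' hc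
      (Or.inr rfl) hf hneg
    exact Or.inr ⟨Or.inr (by rw [hc, hD, neg_one_mul]), Or.inl hD.symm⟩
  · rcases exponent_eq_or_of_discriminantGroupCongr_eq_neg B hB hs hr hsat g hg hd hcc' hc (Or.inl rfl) hf
        hneg with ⟨hD, hodd⟩ | hD
    · exact Or.inl ⟨Or.inl (by rw [hc, hD]), hD.symm, by rw [← Int.odd_coe_nat, hD]; exact hodd⟩
    · exact Or.inr ⟨Or.inl (by rw [hc, hD]), Or.inr hD.symm⟩
  · rcases exponent_eq_or_of_discriminantGroupCongr_eq_neg B hB hs hr hsat g hg hd hcc' hc (Or.inr rfl) hf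
        hneg with ⟨hD, hodd⟩ | hD
    · exact Or.inl ⟨Or.inr (by rw [hc, hD, neg_mul]), hD.symm, by rw [← Int.odd_coe_nat, hD]; exact hodd⟩
    · exact Or.inr ⟨Or.inr (by rw [hc, hD, neg_mul]), Or.inr hD.symm⟩

/-- **GHS Prop. 4.2 (ii) (internal form): if `−σ_r ∈ Õ(L)` then `A_L = ℤx + A_L[2]` for an element `x` of order
`D`** — "`(2L^∨)/L` is a subgroup of the cyclic group generated by `(r/D)+L` or `(2r/D)+L`. This implies (ii)";
the printed product form `A_L ≅ (ℤ/2ℤ)^m × (ℤ/Dℤ)` follows in §6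
(`exists_addEquiv_prod_of_discriminantGroupCongr_eq_neg`).
[cite: GritsenkoHulekSankaran2007Kodaira, §4 (arXiv numbering) Prop. 4.2 (ii) ("`A_L ≅ (ℤ/2ℤ)^m × (ℤ/Dℤ)`")] -/
theorem exists_addOrderOf_eq_exponent_of_discriminantGroupCongr_eq_neg (hB : B.Nondegenerate) (hs : B.IsSymm)
    {r : M} (hr : B r r ≠ 0) (hsat : ∀ (k : ℤ) (w : M), k ≠ 0 → k • w ∈ ℤ ∙ r → w ∈ ℤ ∙ r)
    (g : B.IsometryEquiv B) (hg : ∀ l, B r r • g l = B r r • l - (2 * B l r) • r) {d : ℤ}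
    (hdvd : ∀ z, d ∣ B r z) {r' : M} (hr' : B r r' = d) (hneg : ∀ a, g.discriminantGroupCongr a = -a) :
    ∃ x : B.discriminantGroup, addOrderOf x = AddMonoid.exponent B.discriminantGroup ∧
      ∀ a : B.discriminantGroup, ∃ (k : ℤ) (t : B.discriminantGroup), (2 : ℤ) • t = 0 ∧ a = k • x + t := by
  haveI := finite_discriminantGroup B hB
  have hr0 : r ≠ 0 := fun h ↦ hr (by simp [h])
  obtain ⟨c, c', hcc', hc⟩ := exists_mul_eq_two_and_apply_self_eq_mul_divisor B hs hr hsat g hg hdvd hr'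
  obtain ⟨f, hf⟩ := exists_dual_smul_eq_of_forall_dvd B hdvd
  rcases eq_of_mul_eq_two hcc' with ⟨rfl, rfl⟩ | ⟨rfl, rfl⟩ | ⟨rfl, rfl⟩ | ⟨rfl, rfl⟩
  · exact exists_addOrderOf_eq_exponent_of_forall_eq_zsmul_add
      (forall_eq_zsmul_mk_add_of_discriminantGroupCongr_eq_neg B hs hr g hg hcc' hc (Or.inl rfl) hf hneg)
  · exact exists_addOrderOf_eq_exponent_of_forall_eq_zsmul_add
      (forall_eq_zsmul_mk_add_of_discriminantGroupCongr_eq_neg B hs hr g hg hcc' hc (Or.inr rfl) hf hneg)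
  · obtain ⟨φ₀, hφ₀⟩ := exists_dual_apply_eq_one_of_primitive hr0 hsat
    exact exists_addOrderOf_eq_exponent_of_forall_eq_zsmul_add
      (forall_eq_zsmul_mk_add_of_discriminantGroupCongr_eq_neg_of_apply_eq_one B hs hr g hg hcc' hc hf hneg hφ₀)
  · obtain ⟨φ₀, hφ₀⟩ := exists_dual_apply_eq_one_of_primitive hr0 hsat
    exact exists_addOrderOf_eq_exponent_of_forall_eq_zsmul_add
      (forall_eq_zsmul_mk_add_of_discriminantGroupCongr_eq_neg_of_apply_eq_one B hs hr g hg hcc' hc hf hneg hφ₀)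

end Necessity

/-! ### §4 Sufficiency: the two criteria behind (iii) and (iv) -/

section Sufficiency

variable {M : Type u} [AddCommGroup M] [Module.Free ℤ M] (B : BilinForm ℤ M)

omit [Module.Free ℤ M] in
/-- A `2`-torsion class `t = [τ]` of `A_L` has `2τ = (w₁, ·)` for some `w₁ ∈ L`. [folklore] -/
private theorem exists_apply_eq_two_smul_of_two_zsmul_mk_eq_zero {τ : Module.Dual ℤ M}
    (ht : (2 : ℤ) • (Submodule.Quotient.mk τ : B.discriminantGroup) = 0) : ∃ w₁ : M, B w₁ = (2 : ℤ) • τ := by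
  rw [zsmul_mk, Submodule.Quotient.mk_eq_zero] at ht
  exact LinearMap.mem_range.1 ht

omit [Module.Free ℤ M] in
/-- `d ∣ 2m` with `d` odd gives `d ∣ m`. [folklore] -/
private theorem dvd_of_odd_of_dvd_two_mul {d m : ℤ} (hodd : Odd d) (h : d ∣ 2 * m) : d ∣ m := by
  obtain ⟨j, hj⟩ := hodd
  obtain ⟨q, hq⟩ := h
  exact ⟨m - j * q, by linear_combination (-j) * hq + (-m) * hj⟩

/-- **Criterion for `div(r) = |r²|` (`c = ±1`): `A_L = ℤ[r*] + A_L[2] ⟹ −σ_r ∈ Õ(L)`** — the printed computation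
of (iii): "for any `l^∨ ∈ L^∨`, `2l^∨ = 2x r* + l'` […] `((2l^∨, r)/r²) r = 2x r* ± ((l', r)/D) r ≡ 2x r* ≡ 2l^∨
mod L`". Here `[φ] = k[r*] + [τ]` with `2τ = (w₁,·)`, `φ − k r* − τ = (w₂,·)`, and
`2k − c'φ(r) = −c'τ(r) − c'(w₂, r) ≡ 0 mod div(r)` because `c' = ±2` and `div(r)` divides `(w₁, r)`, `(w₂, r)`.
[cite: GritsenkoHulekSankaran2007Kodaira, §4 (arXiv numbering) Prop. 4.2 proof of (iii), case `div(r) = D`] -/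
theorem discriminantGroupCongr_eq_neg_of_forall_eq_zsmul_mk_add (hB : B.Nondegenerate) (hs : B.IsSymm) {r : M}
    (hr : B r r ≠ 0) (hsat : ∀ (k : ℤ) (w : M), k ≠ 0 → k • w ∈ ℤ ∙ r → w ∈ ℤ ∙ r) (g : B.IsometryEquiv B)
    (hg : ∀ l, B r r • g l = B r r • l - (2 * B l r) • r) {d c c' : ℤ} (hd : 0 < d) (hdvd : ∀ z, d ∣ B r z)
    (hcc' : c * c' = 2) (hc : B r r = c * d) (hc1 : c = 1 ∨ c = -1) {f : Module.Dual ℤ M} (hf : d • f = B r)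
    (hgen : ∀ a : B.discriminantGroup, ∃ (k : ℤ) (t : B.discriminantGroup),
      (2 : ℤ) • t = 0 ∧ a = k • Submodule.Quotient.mk f + t) :
    ∀ a, g.discriminantGroupCongr a = -a := by
  have hr0 : r ≠ 0 := fun h ↦ hr (by simp [h])
  have hc' : c' = 2 * c := by rcases hc1 with rfl | rfl <;> linarith
  have hfr : f r = c := dual_apply_self_eq_of_smul_eq B hd.ne' hf hc
  rw [forall_discriminantGroupCongr_eq_neg_iff_mk B hs hr g hg hcc' hc hf]
  intro φ
  obtain ⟨k, t, ht, hφ⟩ := hgen (Submodule.Quotient.mk φ)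
  obtain ⟨τ, rfl⟩ := B.discriminantGroup_mk_surjective t
  obtain ⟨w₁, hw₁⟩ := exists_apply_eq_two_smul_of_two_zsmul_mk_eq_zero B ht
  have hφ' : (Submodule.Quotient.mk (φ - k • f - τ) : B.discriminantGroup) = 0 := by
    rw [Submodule.Quotient.mk_sub, Submodule.Quotient.mk_sub, ← zsmul_mk, hφ]
    abel
  obtain ⟨w₂, hw₂⟩ := LinearMap.mem_range.1 ((Submodule.Quotient.mk_eq_zero _).1 hφ')
  -- evaluate at `r`
  have h1 : φ r = k * c + τ r + B w₂ r := by
    have := LinearMap.congr_fun hw₂ r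
    rw [LinearMap.sub_apply, LinearMap.sub_apply, LinearMap.smul_apply, smul_eq_mul, hfr] at this
    linarith
  have h2 : (2 : ℤ) * τ r = B w₁ r := by
    have := LinearMap.congr_fun hw₁ r
    rw [LinearMap.smul_apply, smul_eq_mul] at this
    exact this.symm
  -- `2[φ] − c'φ(r)[r*] = (2k − c'φ(r))[r*] = 0`
  rw [hφ, zsmul_add, ht, add_zero, smul_smul, ← sub_eq_zero, ← sub_smul, zsmul_mk,
    zsmul_mk_eq_zero_iff_dvd_of_primitive hB hd.ne' hf hr0 hsat]
  have hcsq : c * c = 1 := by rcases hc1 with rfl | rfl <;> norm_num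
  have h3 : 2 * k - c' * φ r = -(c * (B w₁ r + 2 * B w₂ r)) := by
    rw [h1, hc']; linear_combination (-2 * k) * hcsq - c * h2
  rw [h3, dvd_neg, hs.eq w₁ r, hs.eq w₂ r]
  exact Dvd.dvd.mul_left ((hdvd w₁).add (Dvd.dvd.mul_left (hdvd w₂) 2)) c

/-- **Criterion for `2div(r) = |r²|` (`c = ±2`), `div(r)` odd: `2A_L ⊆ ℤ[r*] ⟹ −σ_r ∈ Õ(L)`** — the printed
computation of (iii) second case and of (iv): "`2l^∨ = 2x r* + l'` […] Thus `(l', r)` is even. But `(l', r)` is also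
divisible by the odd number […]". Here `2[φ] = k[r*]`, `2φ − k r* = (w₂, ·)`, `2(k − c'φ(r)) = −c'(w₂, r) ≡ 0` and
`div(r)` odd. [cite: GritsenkoHulekSankaran2007Kodaira, §4 (arXiv numbering) Prop. 4.2 proof of (iii) second case and (iv)] -/
theorem discriminantGroupCongr_eq_neg_of_two_zsmul_mem_zmultiples_mk (hB : B.Nondegenerate) (hs : B.IsSymm)
    {r : M} (hr : B r r ≠ 0) (hsat : ∀ (k : ℤ) (w : M), k ≠ 0 → k • w ∈ ℤ ∙ r → w ∈ ℤ ∙ r)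
    (g : B.IsometryEquiv B) (hg : ∀ l, B r r • g l = B r r • l - (2 * B l r) • r) {d c c' : ℤ} (hd : 0 < d)
    (hodd : Odd d) (hdvd : ∀ z, d ∣ B r z) (hcc' : c * c' = 2) (hc : B r r = c * d) (hc2 : c = 2 ∨ c = -2)
    {f : Module.Dual ℤ M} (hf : d • f = B r)
    (h2A : ∀ a : B.discriminantGroup, ∃ k : ℤ, (2 : ℤ) • a = k • Submodule.Quotient.mk f) :
    ∀ a, g.discriminantGroupCongr a = -a := by
  have hr0 : r ≠ 0 := fun h ↦ hr (by simp [h])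
  have hcc : c = 2 * c' := by rcases hc2 with rfl | rfl <;> linarith
  have hc'sq : c' * c' = 1 := by rcases hc2 with rfl | rfl <;> nlinarith
  have hfr : f r = c := dual_apply_self_eq_of_smul_eq B hd.ne' hf hc
  rw [forall_discriminantGroupCongr_eq_neg_iff_mk B hs hr g hg hcc' hc hf]
  intro φ
  obtain ⟨k, hk⟩ := h2A (Submodule.Quotient.mk φ)
  have hk' : (Submodule.Quotient.mk ((2 : ℤ) • φ - k • f) : B.discriminantGroup) = 0 := by
    rw [Submodule.Quotient.mk_sub, ← zsmul_mk, ← zsmul_mk, hk, sub_self]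
  obtain ⟨w₂, hw₂⟩ := LinearMap.mem_range.1 ((Submodule.Quotient.mk_eq_zero _).1 hk')
  have h1 : 2 * φ r = k * c + B w₂ r := by
    have := LinearMap.congr_fun hw₂ r
    rw [LinearMap.sub_apply, LinearMap.smul_apply, LinearMap.smul_apply, smul_eq_mul, smul_eq_mul, hfr] at this
    linarith
  rw [hk, ← sub_eq_zero, ← sub_smul, zsmul_mk, zsmul_mk_eq_zero_iff_dvd_of_primitive hB hd.ne' hf hr0 hsat]
  refine dvd_of_odd_of_dvd_two_mul hodd ?_
  have h3 : 2 * (k - c' * φ r) = -(c' * B w₂ r) := by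
    rw [mul_sub, show 2 * (c' * φ r) = c' * (2 * φ r) by ring, h1, hcc]; linear_combination (-k) * 2 * hc'sq
  rw [h3, dvd_neg, hs.eq w₂ r]
  exact Dvd.dvd.mul_left (hdvd w₂) c'

end Sufficiency

/-! ### §5 Prop. 4.2 (iii) and (iv), as printed (under (ii)) -/

section Converse

variable {M : Type u} [AddCommGroup M] [Module.Free ℤ M] [Module.Finite ℤ M] (B : BilinForm ℤ M)

/-- **GHS Prop. 4.2 (iii), with (ii) as an explicit hypothesis** (the printed proof invokes it: "According to (ii) we
have that for any `l^∨ ∈ L^∨`, `2l^∨ = 2x r* + l'`"): let `L` be a nondegenerate even lattice, `r` primitive and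
reflective, `A_L = ℤx + A_L[2]` with `ord x = D` the exponent of `A_L`. If `r² = ±D` and either `div(r) = D` or
`div(r) = D/2` is odd, then `−σ_r ∈ Õ(L)`. (Case `div(r) = D`: `2A_L = ℤ(2x) = ℤ(2[r*])`, both cyclic of order `D/2`,
so `A_L = ℤ[r*] + A_L[2]`; case `div(r) = D/2` odd: `[r*] ∈ ℤ(2x)` has order `D/2 = ord(2x)`, so `2A_L ⊆ ℤ[r*]`.)
[cite: GritsenkoHulekSankaran2007Kodaira, §4 (arXiv numbering) Prop. 4.2 (iii) ("If `r² = ±D` and either `div(r) = D` or `div(r) = D/2 ≡ 1 mod 2`, then `−σ_r ∈ Õ(L)`")] -/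
theorem discriminantGroupCongr_eq_neg_of_apply_self_eq_exponent (hB : B.Nondegenerate) (hs : B.IsSymm)
    (he : B.IsEven) {r : M} (hr : B r r ≠ 0) (hsat : ∀ (k : ℤ) (w : M), k ≠ 0 → k • w ∈ ℤ ∙ r → w ∈ ℤ ∙ r)
    (g : B.IsometryEquiv B) (hg : ∀ l, B r r • g l = B r r • l - (2 * B l r) • r) {d : ℤ} (hd : 0 < d)
    (hdvd : ∀ z, d ∣ B r z)
    (hii : ∃ x : B.discriminantGroup, addOrderOf x = AddMonoid.exponent B.discriminantGroup ∧
      ∀ a : B.discriminantGroup, ∃ (k : ℤ) (t : B.discriminantGroup), (2 : ℤ) • t = 0 ∧ a = k • x + t)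
    (hr2 : B r r = AddMonoid.exponent B.discriminantGroup ∨ B r r = -(AddMonoid.exponent B.discriminantGroup : ℤ))
    (hdiv : d = AddMonoid.exponent B.discriminantGroup ∨ (2 * d = AddMonoid.exponent B.discriminantGroup ∧ Odd d)) :
    ∀ a, g.discriminantGroupCongr a = -a := by
  haveI := finite_discriminantGroup B hB
  have hr0 : r ≠ 0 := fun h ↦ hr (by simp [h])
  obtain ⟨f, hf⟩ := exists_dual_smul_eq_of_forall_dvd B hdvd
  have hord := addOrderOf_mk_eq_natAbs_of_primitive hB hd.ne' hf hr0 hsat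
  have hdabs : (d.natAbs : ℤ) = d := by rw [Int.natCast_natAbs, abs_of_pos hd]
  obtain ⟨x, hx, hgenx⟩ := hii
  -- `2A_L ⊆ ℤ(2x)`
  have h2x : ∀ a : B.discriminantGroup, (2 : ℤ) • a ∈ AddSubgroup.zmultiples ((2 : ℤ) • x) := fun a ↦ by
    obtain ⟨k, t, ht, rfl⟩ := hgenx a
    rw [zsmul_add, ht, add_zero, smul_comm]
    exact AddSubgroup.zsmul_mem _ (AddSubgroup.mem_zmultiples _) k
  rcases hdiv with hdD | ⟨hdD, hodd⟩
  · -- `div(r) = D = |r²|`: `c = ±1`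
    have hc1 : ∃ c c' : ℤ, c * c' = 2 ∧ B r r = c * d ∧ (c = 1 ∨ c = -1) := by
      rcases hr2 with h | h
      · exact ⟨1, 2, by norm_num, by rw [h, hdD, one_mul], Or.inl rfl⟩
      · exact ⟨-1, -2, by norm_num, by rw [h, hdD, neg_one_mul], Or.inr rfl⟩
    obtain ⟨c, c', hcc', hc, hc1⟩ := hc1
    refine discriminantGroupCongr_eq_neg_of_forall_eq_zsmul_mk_add B hB hs hr hsat g hg hd hdvd hcc' hc hc1 hf ?_
    -- `D` is even
    have hDev : Even (AddMonoid.exponent B.discriminantGroup) := by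
      obtain ⟨k, hk⟩ := he r
      have h2 : (2 : ℤ) ∣ (AddMonoid.exponent B.discriminantGroup : ℤ) := by
        rcases hr2 with h | h
        · exact ⟨k, by rw [← h, hk, two_mul]⟩
        · exact ⟨-k, by linarith⟩
      exact even_iff_two_dvd.2 (by exact_mod_cast h2)
    -- `ord(2x) = D/2 = ord(2[r*])`, so `ℤ(2[r*]) = ℤ(2x)`
    have hordx : addOrderOf ((2 : ℤ) • x) = AddMonoid.exponent B.discriminantGroup / 2 := by
      rw [addOrderOf_two_zsmul, hx, Nat.gcd_eq_right (even_iff_two_dvd.1 hDev)]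
    have hordf : addOrderOf ((2 : ℤ) • (Submodule.Quotient.mk f : B.discriminantGroup)) =
        AddMonoid.exponent B.discriminantGroup / 2 := by
      have hD : d.natAbs = AddMonoid.exponent B.discriminantGroup := by
        rw [← Int.natAbs_natCast (AddMonoid.exponent _), ← hdD]
      rw [addOrderOf_two_zsmul, hord, hD, Nat.gcd_eq_right (even_iff_two_dvd.1 hDev)]
    have heq := zmultiples_eq_of_mem_of_addOrderOf_eq (h2x (Submodule.Quotient.mk f)) (hordf.trans hordx.symm)
    intro a
    obtain ⟨m, hm⟩ := AddSubgroup.mem_zmultiples_iff.1 (heq.symm ▸ h2x a :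
      (2 : ℤ) • a ∈ AddSubgroup.zmultiples ((2 : ℤ) • (Submodule.Quotient.mk f : B.discriminantGroup)))
    refine ⟨m, a - m • Submodule.Quotient.mk f, ?_, by abel⟩
    rw [zsmul_sub, ← hm, smul_comm, sub_self]
  · -- `div(r) = D/2 = |r²|/2` odd: `c = ±2`
    have hc2 : ∃ c c' : ℤ, c * c' = 2 ∧ B r r = c * d ∧ (c = 2 ∨ c = -2) := by
      rcases hr2 with h | h
      · exact ⟨2, 1, by norm_num, by rw [h, ← hdD], Or.inl rfl⟩
      · exact ⟨-2, -1, by norm_num, by rw [h, ← hdD, neg_mul], Or.inr rfl⟩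
    obtain ⟨c, c', hcc', hc, hc2⟩ := hc2
    refine discriminantGroupCongr_eq_neg_of_two_zsmul_mem_zmultiples_mk B hB hs hr hsat g hg hd hodd hdvd hcc' hc
      hc2 hf ?_
    -- `[r*] ∈ ℤ(2x)`: `[r*] = kx + t`, `d[r*] = 0`, `d` odd gives `t = −dk·x` and `[r*] = k(1 − d)x`, `1 − d` even
    have hdf : d • (Submodule.Quotient.mk f : B.discriminantGroup) = 0 := by
      rw [zsmul_mk, hf]
      exact B.discriminantGroup_mk_apply r
    obtain ⟨j, hj⟩ := hodd
    have hfmem : (Submodule.Quotient.mk f : B.discriminantGroup) ∈ AddSubgroup.zmultiples ((2 : ℤ) • x) := by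
      obtain ⟨k, t, ht, hkt⟩ := hgenx (Submodule.Quotient.mk f)
      have hdt : d • t = t := by
        rw [hj, add_smul, one_smul, mul_comm, mul_smul, ht, zsmul_zero, zero_add]
      have ht' : t = -((d * k) • x) := by
        rw [eq_neg_iff_add_eq_zero, add_comm, ← hdt, mul_smul, ← zsmul_add, ← hkt, hdf]
      rw [hkt, ht', ← sub_eq_add_neg, ← sub_smul, show k - d * k = (-(j * k)) * 2 by rw [hj]; ring, mul_smul]
      exact AddSubgroup.zsmul_mem _ (AddSubgroup.mem_zmultiples _) _
    -- orders: `ord[r*] = d = D/2 = ord(2x)`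
    have hordx : addOrderOf ((2 : ℤ) • x) = d.natAbs := by
      rw [addOrderOf_two_zsmul, hx, ← Int.natAbs_natCast (AddMonoid.exponent _), ← hdD, Int.natAbs_mul,
        show (2 : ℤ).natAbs = 2 from rfl, Nat.gcd_mul_right_left, Nat.mul_div_cancel_left _ two_pos]
    have heq := zmultiples_eq_of_mem_of_addOrderOf_eq hfmem (hord.trans hordx.symm)
    intro a
    obtain ⟨m, hm⟩ := AddSubgroup.mem_zmultiples_iff.1 (heq.symm ▸ h2x a :
      (2 : ℤ) • a ∈ AddSubgroup.zmultiples (Submodule.Quotient.mk f : B.discriminantGroup))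
    exact ⟨m, hm.symm⟩

/-- **GHS Prop. 4.2 (iv), with (ii) as an explicit hypothesis** (the printed proof: "`D` is odd and the group `A_L`
is cyclic with generator `r* = r/D`"): let `L` be a nondegenerate even lattice, `r` primitive and reflective,
`A_L = ℤx + A_L[2]` with `ord x = D`. If `r² = ±2D` and `div(r) = D` is odd, then `−σ_r ∈ Õ(L)` (odd exponent kills
the `2`-torsion, so `A_L = ℤx = ℤ[r*]` and `2A_L ⊆ ℤ[r*]`).
[cite: GritsenkoHulekSankaran2007Kodaira, §4 (arXiv numbering) Prop. 4.2 (iv) ("If `r² = ±2D` and `div(r) = D ≡ 1 mod 2`, then `−σ_r ∈ Õ(L)`")] -/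
theorem discriminantGroupCongr_eq_neg_of_apply_self_eq_two_mul_exponent (hB : B.Nondegenerate) (hs : B.IsSymm)
    {r : M} (hr : B r r ≠ 0) (hsat : ∀ (k : ℤ) (w : M), k ≠ 0 → k • w ∈ ℤ ∙ r → w ∈ ℤ ∙ r)
    (g : B.IsometryEquiv B) (hg : ∀ l, B r r • g l = B r r • l - (2 * B l r) • r) {d : ℤ} (hd : 0 < d)
    (hdvd : ∀ z, d ∣ B r z)
    (hii : ∃ x : B.discriminantGroup, addOrderOf x = AddMonoid.exponent B.discriminantGroup ∧
      ∀ a : B.discriminantGroup, ∃ (k : ℤ) (t : B.discriminantGroup), (2 : ℤ) • t = 0 ∧ a = k • x + t)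
    (hr2 : B r r = 2 * AddMonoid.exponent B.discriminantGroup ∨
      B r r = -(2 * AddMonoid.exponent B.discriminantGroup : ℤ))
    (hdD : d = AddMonoid.exponent B.discriminantGroup) (hodd : Odd (AddMonoid.exponent B.discriminantGroup)) :
    ∀ a, g.discriminantGroupCongr a = -a := by
  haveI := finite_discriminantGroup B hB
  have hr0 : r ≠ 0 := fun h ↦ hr (by simp [h])
  obtain ⟨f, hf⟩ := exists_dual_smul_eq_of_forall_dvd B hdvd
  have hord := addOrderOf_mk_eq_natAbs_of_primitive hB hd.ne' hf hr0 hsat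
  obtain ⟨x, hx, hgenx⟩ := hii
  have hc2 : ∃ c c' : ℤ, c * c' = 2 ∧ B r r = c * d ∧ (c = 2 ∨ c = -2) := by
    rcases hr2 with h | h
    · exact ⟨2, 1, by norm_num, by rw [h, hdD], Or.inl rfl⟩
    · exact ⟨-2, -1, by norm_num, by rw [h, hdD, neg_mul], Or.inr rfl⟩
  obtain ⟨c, c', hcc', hc, hc2⟩ := hc2
  have hoddd : Odd d := by rw [hdD, Int.odd_coe_nat]; exact hodd
  refine discriminantGroupCongr_eq_neg_of_two_zsmul_mem_zmultiples_mk B hB hs hr hsat g hg hd hoddd hdvd hcc' hc hc2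
    hf fun a ↦ ?_
  -- `A_L = ℤx` (no `2`-torsion), `[r*] ∈ ℤx` of order `D = ord x`, so `ℤ[r*] = ℤx ∋ 2a`
  have hA : ∀ a : B.discriminantGroup, a ∈ AddSubgroup.zmultiples x := fun a ↦ by
    obtain ⟨k, t, ht, rfl⟩ := hgenx a
    rw [eq_zero_of_two_zsmul_eq_zero_of_odd_exponent hodd ht, add_zero]
    exact AddSubgroup.zsmul_mem _ (AddSubgroup.mem_zmultiples _) k
  have hordf : addOrderOf (Submodule.Quotient.mk f : B.discriminantGroup) = addOrderOf x := by
    rw [hord, hx, ← Int.natAbs_natCast (AddMonoid.exponent _), ← hdD]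
  have heq := zmultiples_eq_of_mem_of_addOrderOf_eq (hA _) hordf
  obtain ⟨m, hm⟩ := AddSubgroup.mem_zmultiples_iff.1 (heq.symm ▸ hA ((2 : ℤ) • a) :
    (2 : ℤ) • a ∈ AddSubgroup.zmultiples (Submodule.Quotient.mk f : B.discriminantGroup))
  exact ⟨m, hm.symm⟩

end Converse

/-! ### §6 The product form of (ii): `A_L ≅ (ℤ/2ℤ)^m × (ℤ/Dℤ)` -/

section ProductForm

variable {A : Type u} [AddCommGroup A] [Finite A]

/-- **A finite abelian group generated by an element `x` and its `2`-torsion is `≅ ℤ/ord(x) × (ℤ/2)^m`.** The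
quotient `A/ℤx` is an elementary abelian `2`-group, i.e. an `𝔽₂`-vector space, and `A[2] → A/ℤx` is onto, so it
has an `𝔽₂`-linear section `σ`; then `a ↦ (a − σ(ā), ā)` is an isomorphism `A ≅ ℤx × A/ℤx` (the splitting
`E = M × ⟨x⟩` of an elementary abelian group off a cyclic factor, as in the group-theoretic proof of the structure
theorem). This is GHS's "This implies (ii)". [cite: GritsenkoHulekSankaran2007Kodaira, §4 (arXiv numbering) Prop. 4.2 (ii) and its proof] [cite: DummitFoote2004, §6.1 proof of Thm. 5.5 Parts 1–2 ("for any `x ∈ E`, there exists `M ≤ E` with `E = M × ⟨x⟩`")] -/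
theorem exists_addEquiv_zmod_prod_of_forall_eq_zsmul_add {x : A}
    (hgen : ∀ a : A, ∃ (k : ℤ) (t : A), (2 : ℤ) • t = 0 ∧ a = k • x + t) :
    ∃ m : ℕ, Nonempty (A ≃+ ZMod (addOrderOf x) × (Fin m → ZMod 2)) := by
  classical
  -- the `2`-torsion subgroup `T = A[2]` as an `𝔽₂`-module
  let T : AddSubgroup A :=
    { carrier := {t | (2 : ℤ) • t = 0}
      add_mem' := fun {a b} ha hb ↦ by
        simp only [Set.mem_setOf_eq] at ha hb ⊢
        rw [smul_add, ha, hb, add_zero]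
      zero_mem' := smul_zero (2 : ℤ)
      neg_mem' := fun {a} ha ↦ by
        simp only [Set.mem_setOf_eq] at ha ⊢
        rw [smul_neg, ha, neg_zero] }
  have hT : ∀ t : T, 2 • t = 0 := fun t ↦ Subtype.ext (by
    rw [AddSubgroup.coe_nsmul, AddSubgroup.coe_zero, ← natCast_zsmul]
    exact t.2)
  letI : Module (ZMod 2) T := AddCommGroup.zmodModule hT
  -- the cyclic subgroup `C = ℤx`; `2A ⊆ C`, so `A/C` is an `𝔽₂`-module
  let C : AddSubgroup A := AddSubgroup.zmultiples x
  have hC : ∀ a : A, 2 • a ∈ C := fun a ↦ by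
    obtain ⟨k, t, ht, rfl⟩ := hgen a
    rw [← natCast_zsmul, Nat.cast_ofNat, smul_add, ht, add_zero, smul_smul]
    exact AddSubgroup.zsmul_mem _ (AddSubgroup.mem_zmultiples x) _
  letI : Module (ZMod 2) (A ⧸ C) := QuotientAddGroup.zmodModule hC
  let π : A →+ A ⧸ C := QuotientAddGroup.mk' C
  have hπC : ∀ c ∈ C, π c = 0 := fun c hc ↦ (QuotientAddGroup.eq_zero_iff c).2 hc
  -- `T → A/C` is onto; choose an `𝔽₂`-linear section `σ`
  let πT : T →ₗ[ZMod 2] (A ⧸ C) := (π.comp T.subtype).toZModLinearMap 2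
  have hπT_apply : ∀ t : T, πT t = π t := fun t ↦ rfl
  have hπT : LinearMap.range πT = ⊤ := by
    rw [LinearMap.range_eq_top]
    intro q
    obtain ⟨a, rfl⟩ := QuotientAddGroup.mk'_surjective C q
    obtain ⟨k, t, ht, rfl⟩ := hgen a
    refine ⟨⟨t, ht⟩, ?_⟩
    rw [hπT_apply, map_add, hπC _ (AddSubgroup.zsmul_mem _ (AddSubgroup.mem_zmultiples x) k), zero_add]
  obtain ⟨σ, hσ⟩ := πT.exists_rightInverse_of_surjective hπT
  have hsec : ∀ q : A ⧸ C, π (σ q : A) = q := fun q ↦ by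
    rw [← hπT_apply]
    exact LinearMap.congr_fun hσ q
  -- `A ≃+ C × (A/C)`
  have hmemC : ∀ a : A, a - (σ (π a) : A) ∈ C := fun a ↦ by
    rw [← QuotientAddGroup.eq_zero_iff, ← QuotientAddGroup.mk'_apply, map_sub]
    change π a - π (σ (π a) : A) = 0
    rw [hsec, sub_self]
  let e₁ : A ≃+ C × (A ⧸ C) :=
    { toFun := fun a ↦ (⟨a - (σ (π a) : A), hmemC a⟩, π a)
      invFun := fun p ↦ (p.1 : A) + (σ p.2 : A)
      left_inv := fun a ↦ by simp only [sub_add_cancel]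
      right_inv := fun p ↦ by
        have h2 : π ((p.1 : A) + (σ p.2 : A)) = p.2 := by rw [map_add, hπC _ p.1.2, zero_add, hsec]
        ext
        · change (p.1 : A) + (σ p.2 : A) - (σ (π ((p.1 : A) + (σ p.2 : A))) : A) = p.1
          rw [h2, add_sub_cancel_right]
        · exact h2
      map_add' := fun a b ↦ by
        ext
        · change a + b - (σ (π (a + b)) : A) = (a - (σ (π a) : A)) + (b - (σ (π b) : A))
          rw [map_add, map_add, AddSubgroup.coe_add]
          abel
        · exact map_add π a b }
  -- `C ≅ ℤ/ord(x)` and `A/C ≅ (ℤ/2)^m`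
  have hg : ∀ c : C, c ∈ AddSubgroup.zmultiples (⟨x, AddSubgroup.mem_zmultiples x⟩ : C) := fun c ↦ by
    obtain ⟨k, hk⟩ := AddSubgroup.mem_zmultiples_iff.1 c.2
    exact AddSubgroup.mem_zmultiples_iff.2 ⟨k, Subtype.ext (by rw [AddSubgroup.coe_zsmul]; exact hk)⟩
  let e₂ : ZMod (addOrderOf x) ≃+ C := zmodAddEquivOfGenerator hg (Nat.card_zmultiples x)
  haveI : Module.Finite (ZMod 2) (A ⧸ C) := Module.Finite.of_finite
  let b := Module.finBasis (ZMod 2) (A ⧸ C)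
  exact ⟨Module.finrank (ZMod 2) (A ⧸ C), ⟨e₁.trans (e₂.symm.prodCongr b.equivFun.toAddEquiv)⟩⟩

/-- With `ord(x) = exp(A)`: `A ≅ (ℤ/2)^m × ℤ/D`, `D` the exponent — the shape of GHS (ii).
[cite: GritsenkoHulekSankaran2007Kodaira, §4 (arXiv numbering) Prop. 4.2 (ii) ("`A_L ≅ (ℤ/2ℤ)^m × (ℤ/Dℤ)`")] [cite: DummitFoote2004, §6.1 proof of Thm. 5.5 Parts 1–2] -/
theorem exists_addEquiv_prod_zmod_exponent_of_forall_eq_zsmul_add {x : A} (hx : addOrderOf x = AddMonoid.exponent A)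
    (hgen : ∀ a : A, ∃ (k : ℤ) (t : A), (2 : ℤ) • t = 0 ∧ a = k • x + t) :
    ∃ m : ℕ, Nonempty (A ≃+ (Fin m → ZMod 2) × ZMod (AddMonoid.exponent A)) := by
  obtain ⟨m, ⟨e⟩⟩ := exists_addEquiv_zmod_prod_of_forall_eq_zsmul_add hgen
  rw [hx] at e
  exact ⟨m, ⟨e.trans (AddEquiv.prodComm)⟩⟩

end ProductForm

section ProductFormLattice

variable {M : Type u} [AddCommGroup M] [Module.Free ℤ M] [Module.Finite ℤ M] (B : BilinForm ℤ M)

/-- **GHS Prop. 4.2 (ii), as printed: if `−σ_r ∈ Õ(L)` then `A_L ≅ (ℤ/2ℤ)^m × (ℤ/Dℤ)`**, `D` the exponent of `A_L`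
(`r` primitive and reflective in a nondegenerate even — here: nondegenerate symmetric — lattice `L`).
[cite: GritsenkoHulekSankaran2007Kodaira, §4 (arXiv numbering) Prop. 4.2 (ii) ("`A_L ≅ (ℤ/2ℤ)^m × (ℤ/Dℤ)`")] -/
theorem exists_addEquiv_prod_of_discriminantGroupCongr_eq_neg (hB : B.Nondegenerate) (hs : B.IsSymm) {r : M}
    (hr : B r r ≠ 0) (hsat : ∀ (k : ℤ) (w : M), k ≠ 0 → k • w ∈ ℤ ∙ r → w ∈ ℤ ∙ r) (g : B.IsometryEquiv B)
    (hg : ∀ l, B r r • g l = B r r • l - (2 * B l r) • r) {d : ℤ} (hdvd : ∀ z, d ∣ B r z) {r' : M}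
    (hr' : B r r' = d) (hneg : ∀ a, g.discriminantGroupCongr a = -a) :
    ∃ m : ℕ, Nonempty (B.discriminantGroup ≃+
      (Fin m → ZMod 2) × ZMod (AddMonoid.exponent B.discriminantGroup)) := by
  haveI := finite_discriminantGroup B hB
  obtain ⟨x, hx, hgen⟩ :=
    exists_addOrderOf_eq_exponent_of_discriminantGroupCongr_eq_neg B hB hs hr hsat g hg hdvd hr' hneg
  exact exists_addEquiv_prod_zmod_exponent_of_forall_eq_zsmul_add hx hgen

end ProductFormLattice




end Literature.Topology.FourManifolds

end
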